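import Mathlib
import HarnessLib
import Summits.KontsevichZagierPeriods.Zeta5Search.DougallComplexParameters
import Literature.Analysis.Complex.ConeTubeIdentity

/-!
# ζ(5) search — Zudilin's (9) for COMPLEX `h₁, h₂, h₃` (real `h₀`), by slicing (cell `pub-zeta5`, ct-1 g26)

HONEST FRAMING: systematic search; no irrationality claim unless kernel-certified.  An identity of special functions continued
analytically in its parameters; nothing here is an irrationality result; no named fact of the tree is discharged.

Brick B5g (second part) of `HOME/ct-1/g26/VWP-BLUEPRINT.md`.  From `DougallFullRange.zudilin_nine'` (all four parameters
real) and the one-slot holomorphy with complex co-parameters (`DougallComplexParameters`), the identity theorem from the real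
points (`Literature.Analysis.Complex.eqOn_of_isPreconnected_of_eq_ofReal`) is applied three times — slot `h₁`, then `h₂`,
then `h₃` (the series and the Gamma side are symmetric in `h₁, h₂, h₃`):
* `slice` — one-slot continuation: holomorphy on `D = {0 < Re w < 1+Re h₀−Re h₂−Re h₃}` + agreement at the real points of `D`
  ⇒ agreement on `D`;
* `zudilin_nine_complex` — (9) for real `h₀ > 0` and complex `h₁, h₂, h₃` with `Re hⱼ > 0`, `Re(h₁+h₂+h₃) < 1+h₀`
  [cite: Bailey1935, §4.4 (1)].
What remains for B5g: the slot `h₀` (a different majorant — see the blueprint).  Theorems only (no new definitions).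
-/

noncomputable section

namespace Summit.KontsevichZagierPeriods.Zeta5Search.DougallComplexSlices

open Finset Filter Set Metric
open Summit.KontsevichZagierPeriods.Zeta5Search.DougallFullRange (zudilin_nine')
open Summit.KontsevichZagierPeriods.Zeta5Search.DougallComplexParameters (differentiableOn_series_cparam
  differentiableOn_gammaSide_cparam)

/-- **One-slot continuation.**  For complex co-parameters `h₀, h₂, h₃` with positive real parts: if (9) (in the slot
`h₁`) holds at every REAL `h₁ = t` with `0 < t < 1 + Re h₀ − Re h₂ − Re h₃`, then it holds at every complex `h₁ = w` with
`0 < Re w < 1 + Re h₀ − Re h₂ − Re h₃` (both sides are holomorphic in `w` there; identity theorem from the real points). -/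
theorem slice (h₀ h₂ h₃ : ℂ) (hx₀ : 0 < h₀.re) (hx₂ : 0 < h₂.re) (hx₃ : 0 < h₃.re)
    (hreal : ∀ t : ℝ, 0 < t → t < 1 + h₀.re - h₂.re - h₃.re →
      ∑' μ : ℕ, (h₀ + 2 * μ) *
          (Complex.Gamma (h₀ + μ) * Complex.Gamma ((t : ℂ) + μ) * Complex.Gamma (h₂ + μ) * Complex.Gamma (h₃ + μ)) /
          (Complex.Gamma ((μ : ℂ) + 1) * Complex.Gamma (h₀ - t + 1 + μ) * Complex.Gamma (h₀ - h₂ + 1 + μ) *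
            Complex.Gamma (h₀ - h₃ + 1 + μ)) =
        Complex.Gamma t * Complex.Gamma h₂ * Complex.Gamma h₃ * Complex.Gamma (h₀ - t - h₂ - h₃ + 1) /
          (Complex.Gamma (h₀ - t - h₂ + 1) * Complex.Gamma (h₀ - t - h₃ + 1) * Complex.Gamma (h₀ - h₂ - h₃ + 1)))
    {w : ℂ} (hw : 0 < w.re) (hw' : w.re < 1 + h₀.re - h₂.re - h₃.re) :
    ∑' μ : ℕ, (h₀ + 2 * μ) *
        (Complex.Gamma (h₀ + μ) * Complex.Gamma (w + μ) * Complex.Gamma (h₂ + μ) * Complex.Gamma (h₃ + μ)) /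
        (Complex.Gamma ((μ : ℂ) + 1) * Complex.Gamma (h₀ - w + 1 + μ) * Complex.Gamma (h₀ - h₂ + 1 + μ) *
          Complex.Gamma (h₀ - h₃ + 1 + μ)) =
      Complex.Gamma w * Complex.Gamma h₂ * Complex.Gamma h₃ * Complex.Gamma (h₀ - w - h₂ - h₃ + 1) /
        (Complex.Gamma (h₀ - w - h₂ + 1) * Complex.Gamma (h₀ - w - h₃ + 1) * Complex.Gamma (h₀ - h₂ - h₃ + 1)) := by
  set S : ℂ → ℂ := fun w : ℂ => ∑' μ : ℕ, (h₀ + 2 * μ) *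
        (Complex.Gamma (h₀ + μ) * Complex.Gamma (w + μ) * Complex.Gamma (h₂ + μ) * Complex.Gamma (h₃ + μ)) /
        (Complex.Gamma ((μ : ℂ) + 1) * Complex.Gamma (h₀ - w + 1 + μ) * Complex.Gamma (h₀ - h₂ + 1 + μ) *
          Complex.Gamma (h₀ - h₃ + 1 + μ)) with hS
  set G : ℂ → ℂ := fun w : ℂ => Complex.Gamma w * Complex.Gamma h₂ * Complex.Gamma h₃ *
        Complex.Gamma (h₀ - w - h₂ - h₃ + 1) /
        (Complex.Gamma (h₀ - w - h₂ + 1) * Complex.Gamma (h₀ - w - h₃ + 1) * Complex.Gamma (h₀ - h₂ - h₃ + 1)) with hG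
  set D : Set ℂ := {w : ℂ | 0 < w.re ∧ w.re < 1 + h₀.re - h₂.re - h₃.re} with hD
  have hSD : DifferentiableOn ℂ S D := differentiableOn_series_cparam h₀ h₂ h₃ hx₀ hx₂ hx₃
  have hGD : DifferentiableOn ℂ G D := differentiableOn_gammaSide_cparam h₀ h₂ h₃ hx₂ hx₃
  have hDo : IsOpen D :=
    (isOpen_lt continuous_const Complex.continuous_re).inter (isOpen_lt Complex.continuous_re continuous_const)
  have hDc : IsPreconnected D := ((convex_halfSpace_re_gt 0).inter (convex_halfSpace_re_lt _)).isPreconnected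
  have hx : (((1 + h₀.re - h₂.re - h₃.re) / 2 : ℝ) : ℂ) ∈ D := ⟨by simp; linarith, by simp; linarith⟩
  have hEq : EqOn S G D := by
    refine Literature.Analysis.Complex.eqOn_of_isPreconnected_of_eq_ofReal hDo hDc hx hSD hGD fun t ht => ?_
    obtain ⟨ht0, ht1⟩ := ht
    simp only [Complex.ofReal_re] at ht0 ht1
    exact hreal t ht0 ht1
  exact hEq (show w ∈ D from ⟨hw, hw'⟩)

/-- **Zudilin's (9) for complex `h₁, h₂, h₃`** (real `h₀ > 0`, `Re hⱼ > 0`, `Re h₁ + Re h₂ + Re h₃ < 1 + h₀`):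
`Σ_μ (h₀+2μ)Γ(h₀+μ)Γ(h₁+μ)Γ(h₂+μ)Γ(h₃+μ)/(Γ(μ+1)Γ(h₀−h₁+1+μ)Γ(h₀−h₂+1+μ)Γ(h₀−h₃+1+μ))
 = Γ(h₁)Γ(h₂)Γ(h₃)Γ(h₀−h₁−h₂−h₃+1)/(Γ(h₀−h₁−h₂+1)Γ(h₀−h₁−h₃+1)Γ(h₀−h₂−h₃+1))` — three slices (`h₁`, `h₂`, `h₃`) of
`slice`, anchored at `zudilin_nine'`, using the symmetry of both sides in `(h₁, h₂, h₃)`. [cite: Bailey1935, §4.4 (1)] -/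
theorem zudilin_nine_complex (h₀ : ℝ) (h₁ h₂ h₃ : ℂ) (hh₀ : 0 < h₀) (hx₁ : 0 < h₁.re) (hx₂ : 0 < h₂.re)
    (hx₃ : 0 < h₃.re) (hs : h₁.re + h₂.re + h₃.re < 1 + h₀) :
    ∑' μ : ℕ, ((h₀ : ℂ) + 2 * μ) *
        (Complex.Gamma ((h₀ : ℂ) + μ) * Complex.Gamma (h₁ + μ) * Complex.Gamma (h₂ + μ) * Complex.Gamma (h₃ + μ)) /
        (Complex.Gamma ((μ : ℂ) + 1) * Complex.Gamma ((h₀ : ℂ) - h₁ + 1 + μ) * Complex.Gamma ((h₀ : ℂ) - h₂ + 1 + μ) *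
          Complex.Gamma ((h₀ : ℂ) - h₃ + 1 + μ)) =
      Complex.Gamma h₁ * Complex.Gamma h₂ * Complex.Gamma h₃ * Complex.Gamma ((h₀ : ℂ) - h₁ - h₂ - h₃ + 1) /
        (Complex.Gamma ((h₀ : ℂ) - h₁ - h₂ + 1) * Complex.Gamma ((h₀ : ℂ) - h₁ - h₃ + 1) *
          Complex.Gamma ((h₀ : ℂ) - h₂ - h₃ + 1)) := by
  have hx₀ : 0 < ((h₀ : ℂ)).re := by simpa using hh₀
  -- slice 1: complex `h₁`, real `h₂ = a`, `h₃ = b`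
  have stepA : ∀ (a b : ℝ), 0 < a → 0 < b → ∀ w : ℂ, 0 < w.re → w.re < 1 + h₀ - a - b →
      ∑' μ : ℕ, ((h₀ : ℂ) + 2 * μ) *
          (Complex.Gamma ((h₀ : ℂ) + μ) * Complex.Gamma (w + μ) * Complex.Gamma ((a : ℂ) + μ) *
            Complex.Gamma ((b : ℂ) + μ)) /
          (Complex.Gamma ((μ : ℂ) + 1) * Complex.Gamma ((h₀ : ℂ) - w + 1 + μ) * Complex.Gamma ((h₀ : ℂ) - a + 1 + μ) *
            Complex.Gamma ((h₀ : ℂ) - b + 1 + μ)) =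
        Complex.Gamma w * Complex.Gamma a * Complex.Gamma b * Complex.Gamma ((h₀ : ℂ) - w - a - b + 1) /
          (Complex.Gamma ((h₀ : ℂ) - w - a + 1) * Complex.Gamma ((h₀ : ℂ) - w - b + 1) *
            Complex.Gamma ((h₀ : ℂ) - a - b + 1)) := by
    intro a b ha hb w hw hw'
    refine slice (h₀ : ℂ) (a : ℂ) (b : ℂ) hx₀ (by simpa using ha) (by simpa using hb) (fun t ht ht' => ?_) hw
      (by simpa using hw')
    simp only [Complex.ofReal_re] at ht'
    exact zudilin_nine' h₀ t a b hh₀ ht ha hb (by linarith)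
  -- slice 2: complex `h₂ = p` (slot 1 real anchor from slice 1 by the symmetry `h₁ ↔ h₂`), real `h₃ = b`
  have stepB : ∀ (p : ℂ) (b : ℝ), 0 < p.re → 0 < b → ∀ w : ℂ, 0 < w.re → w.re < 1 + h₀ - p.re - b →
      ∑' μ : ℕ, ((h₀ : ℂ) + 2 * μ) *
          (Complex.Gamma ((h₀ : ℂ) + μ) * Complex.Gamma (w + μ) * Complex.Gamma (p + μ) *
            Complex.Gamma ((b : ℂ) + μ)) /
          (Complex.Gamma ((μ : ℂ) + 1) * Complex.Gamma ((h₀ : ℂ) - w + 1 + μ) * Complex.Gamma ((h₀ : ℂ) - p + 1 + μ) *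
            Complex.Gamma ((h₀ : ℂ) - b + 1 + μ)) =
        Complex.Gamma w * Complex.Gamma p * Complex.Gamma b * Complex.Gamma ((h₀ : ℂ) - w - p - b + 1) /
          (Complex.Gamma ((h₀ : ℂ) - w - p + 1) * Complex.Gamma ((h₀ : ℂ) - w - b + 1) *
            Complex.Gamma ((h₀ : ℂ) - p - b + 1)) := by
    intro p b hp hb w hw hw'
    refine slice (h₀ : ℂ) p (b : ℂ) hx₀ hp (by simpa using hb) (fun t ht ht' => ?_) hw (by simpa using hw')
    simp only [Complex.ofReal_re] at ht'
    have key := stepA t b ht hb p hp (by linarith)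
    convert key using 1
    · exact tsum_congr fun μ => by ring
    · ring_nf
  -- slice 3: complex `h₃ = q` (anchor from slice 2 by the symmetry `h₁ ↔ h₃`)
  have stepC : ∀ (p q : ℂ), 0 < p.re → 0 < q.re → ∀ w : ℂ, 0 < w.re → w.re < 1 + h₀ - p.re - q.re →
      ∑' μ : ℕ, ((h₀ : ℂ) + 2 * μ) *
          (Complex.Gamma ((h₀ : ℂ) + μ) * Complex.Gamma (w + μ) * Complex.Gamma (p + μ) * Complex.Gamma (q + μ)) /
          (Complex.Gamma ((μ : ℂ) + 1) * Complex.Gamma ((h₀ : ℂ) - w + 1 + μ) * Complex.Gamma ((h₀ : ℂ) - p + 1 + μ) *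
            Complex.Gamma ((h₀ : ℂ) - q + 1 + μ)) =
        Complex.Gamma w * Complex.Gamma p * Complex.Gamma q * Complex.Gamma ((h₀ : ℂ) - w - p - q + 1) /
          (Complex.Gamma ((h₀ : ℂ) - w - p + 1) * Complex.Gamma ((h₀ : ℂ) - w - q + 1) *
            Complex.Gamma ((h₀ : ℂ) - p - q + 1)) := by
    intro p q hp hq w hw hw'
    refine slice (h₀ : ℂ) p q hx₀ hp hq (fun t ht ht' => ?_) hw (by simpa using hw')
    simp only [Complex.ofReal_re] at ht'
    have key := stepB p t hp ht q hq (by linarith)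
    convert key using 1
    · exact tsum_congr fun μ => by ring
    · ring_nf
  exact stepC h₂ h₃ hx₂ hx₃ h₁ hx₁ (by linarith)

end Summit.KontsevichZagierPeriods.Zeta5Search.DougallComplexSlices

end
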